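import Summits.NavierStokesRegularity.NavierStokesRegularity.Theorems.OddMorawetzLocal.Negative.OddMorawetzLocalRefutationData5
import Summits.NavierStokesRegularity.NavierStokesRegularity.Theorems.OddMorawetzLocal.Negative.OddMorawetzLocalRefutationDefsV
import HarnessLib

/-!
# Crux `OddMorawetzLocal` (stmt-NavierStokesRegularity-1376) — kernel certificates, weight 5 (part D3)

The finite computations of the weight-5 half of the refutation, each a closed Boolean evaluated by the kernel
(`decide +kernel`) on the vocabulary of `OddMorawetzLocalJetAlgebra` / `…RefutationDefs{,Fast,IV,V}` and the literal
data of `…RefutationData5`.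
Parts D1–D3: `cert5_iso_recon_*` — every isotropic basis polynomial is the combination of normalised orbit sums given by
its orbit coordinates.
Chunks of two descriptors per theorem (kernel memory). No analysis; lands `--supports` the crux item.
-/

set_option linter.dupNamespace false

namespace Summit.NavierStokesRegularity.NavierStokesRegularity.Theorems.OddMorawetz

/-- Isotropic basis elements `36`, `37`: reconstructed from their orbit coordinates. -/
theorem cert5_iso_recon_18 : (((isoDesc5.drop 36).take 2).all fun d => orbitReconF reps5 (isoPolyF d)) = true := by
  decide +kernel

/-- Isotropic basis elements `38`, `39`: reconstructed from their orbit coordinates. -/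
theorem cert5_iso_recon_19 : (((isoDesc5.drop 38).take 2).all fun d => orbitReconF reps5 (isoPolyF d)) = true := by
  decide +kernel

/-- Isotropic basis elements `40`, `41`: reconstructed from their orbit coordinates. -/
theorem cert5_iso_recon_20 : (((isoDesc5.drop 40).take 2).all fun d => orbitReconF reps5 (isoPolyF d)) = true := by
  decide +kernel

/-- Isotropic basis elements `42`, `43`: reconstructed from their orbit coordinates. -/
theorem cert5_iso_recon_21 : (((isoDesc5.drop 42).take 2).all fun d => orbitReconF reps5 (isoPolyF d)) = true := by
  decide +kernel

/-- Isotropic basis elements `44`, `45`: reconstructed from their orbit coordinates. -/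
theorem cert5_iso_recon_22 : (((isoDesc5.drop 44).take 2).all fun d => orbitReconF reps5 (isoPolyF d)) = true := by
  decide +kernel

/-- Isotropic basis elements `46`, `47`: reconstructed from their orbit coordinates. -/
theorem cert5_iso_recon_23 : (((isoDesc5.drop 46).take 2).all fun d => orbitReconF reps5 (isoPolyF d)) = true := by
  decide +kernel

/-- Isotropic basis elements `48`, `49`: reconstructed from their orbit coordinates. -/
theorem cert5_iso_recon_24 : (((isoDesc5.drop 48).take 2).all fun d => orbitReconF reps5 (isoPolyF d)) = true := by
  decide +kernel

end Summit.NavierStokesRegularity.NavierStokesRegularity.Theorems.OddMorawetz
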